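import Summits.CriticalPhenomena.PercolationContinuityZ3.Theorems.PercNearOneGluingNoHeavyQuantTreeBuiltAD3Cells
import Summits.CriticalPhenomena.PercolationContinuityZ3.Theorems.PercNearOneGluingNoHeavyQuantLawDecFlowsDecomposition
import Summits.CriticalPhenomena.PercolationContinuityZ3.Theorems.PercNearOneGluingNoHeavyQuantFlowPieces
import Summits.CriticalPhenomena.PercolationContinuityZ3.Theorems.PercNearOneGluingNoHeavyQuantLawDecUsageMonge
import HarnessLib

/-!
# QUANT lane R8, Route 2 — the product cell `LawDec.AD3ProdCell` is FALSE, part 1: the weak-duality cuts of the witness frame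

builds on p205010 (kernel theorem, internal audit signed; external expert review pending)

Support file (`--supports stmt-CriticalPhenomena-4575`), QUANT lane seat prim-quant-arm-2 (gen 37), rung R8 of
`run/shared/lean/prim/quant/LADDER.md`.  Memo `run/shared/lean/prim/quant/prim-quant-arm-2-g37/CEX-AD3PRODCELL-G37.md` (exact certificate
`cex/cex_prodcell_triple.json`, two independent exact DEC implementations).  Theorems only, standard axioms, no sorries.

THE WITNESS (refutes typer g31's `@[conjecture] LawDec.AD3ProdCell` of `…QuantTreeBuiltAD3Cells`, and with lead g35's split also
`AD3ProdCellTriple`).  Floor `y = 99/125`, gate `q = 99/100`; components `ω₁ = TR[1,2,4; 1/10,1/5,7/10]` at `M₁ = 4` (`T₁ = 33/10`, an admissible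
residue triple) and `ω₂ = TP[0,8; 4/5]` at `M₂ = 8` (`T₂ = 32/5`, a heavy pair AT THRESHOLD `qγ = y`, top-affordability tight).  Their product
`{1: 1/50, 2: 1/25, 4: 7/50, 9: 2/25, 10: 4/25, 12: 14/25}` (`M = 12`, `T = 97/10`) is NOT `AD3Decomp`: every component of a decomposition lives on
`S = {1,2,4,9,10,12}` with mean `97/10`, its `q`-gate has mean `τ = 9603/1000`, and the linear functional
`Φ = (10913/331279)·μ1 + (5/17)·μ2 + μ4 − μ9 − (11/17)·μ10 + (1/17)·μ12` is `≤ 0` on every such component but `Φ(product) = 608/331279 > 0`.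

THIS FILE: the frame's rates and the three price systems for `LawDec.dual_le_of_decAtT` (typer g22) that bound `Φ` on the components which are
not handled by the mean alone — P1 (layer 11, the giant `12` alone: light top pairs `{k,12}` and the triples `{1,2,12}`, `{1,4,12}`, `{2,4,12}`),
P2 (layer 5, giants `≥ 6`: triples `{2,9,12}`, `{2,10,12}`, `{4,9,12}`, `{4,10,12}` have low mass `≤ 1/5`), P3 (layer 11 with the mid `9` or `10`
priced at its exact rate: triples `{1,9,12}`, `{1,10,12}`) — and the admissibility of the witness triple `ω₁` (its top atom `4 = M₁` is a giant
at every layer; `LawDec.flowAtT_of_giants`).  Giant rate `usage_giant_eq`: typer (`…LawDecUsageMonge`).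

* `AD3ProdCellCex.lightTop_absurd` — a light pair `{k, 12}` (`k ∈ {1,2,4}`) is not admissible at `M = 12`.
* `AD3ProdCellCex.triple_lowTop_absurd` — `{a, b, 12}` with `b ≤ 4` is never admissible (mean forces `q·p₁₂ < y`).
* `AD3ProdCellCex.triple_P2_cut`, `AD3ProdCellCex.triple_P3_cut_1_9`, `…_1_10` — the cuts.
* `AD3ProdCellCex.omega1_dec` — `gate_q ω₁` is DEC at every layer `j′ < 4`.

[this work].  Weak duality for the flow form: prim-quant-stmt g22 (`dual_le_of_decAtT`).  Nothing here is cited as a published result.  The gluing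
rows served [cite: KozmaNitzan2024, Conjecture 3 (p. 15)]; product measure [cite: Grimmett1999, §1.3 p. 10].
-/

noncomputable section

namespace Summit.CriticalPhenomena.PercolationContinuityZ3.Theorems

namespace Quant

open Finset

/-- two-point law notation `TP[lo, hi, g, h] = g·[h = hi] + (1 − g)·[h = lo]` (as in the lane's other files). -/
local notation3 "TP[" lo ", " hi ", " g ", " h "]" =>
  (g : ℝ) * (if (h : ℕ) = (hi : ℕ) then (1 : ℝ) else 0) + (1 - (g : ℝ)) * (if (h : ℕ) = (lo : ℕ) then (1 : ℝ) else 0)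

/-- three-atom law notation `TR[s₁, s₂, s₃, p₁, p₂, p₃, h] = p₁·[h = s₁] + p₂·[h = s₂] + p₃·[h = s₃]`. -/
local notation3 "TR[" s₁ ", " s₂ ", " s₃ ", " p₁ ", " p₂ ", " p₃ ", " h "]" =>
  (p₁ : ℝ) * (if (h : ℕ) = (s₁ : ℕ) then (1 : ℝ) else 0) + (p₂ : ℝ) * (if (h : ℕ) = (s₂ : ℕ) then (1 : ℝ) else 0)
    + (p₃ : ℝ) * (if (h : ℕ) = (s₃ : ℕ) then (1 : ℝ) else 0)

namespace LawDec

namespace AD3ProdCellCex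

/-! ### Rates of the witness frame `(y, τ) = (99/125, 9603/1000)` -/

/-- the rate of a compatible mid pair is at least its `ρ` (frame `99/125`, `9603/1000`, layer `11`). [this work] -/
theorem usage_ge_rho (l h : ℕ) (hlow : 2 * (l : ℝ) < 9603/1000) (hcomp : (9603/1000 : ℝ) < (l : ℝ) + h) (hh : ¬ 11 + 1 ≤ h) :
    (9603/1000 - 2 * (l : ℝ)) / ((h : ℝ) - l) ≤ usage (99/125) (9603/1000) 11 l h := by
  have hlt : l < h := by
    by_contra hcon
    push Not at hcon
    have : (h : ℝ) ≤ l := by exact_mod_cast hcon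
    linarith
  have hG0 := pairGate_pos (99/125) (9603/1000) l h hlow hlt
  have hG1 := pairGate_lt_one (99/125) (9603/1000) l h (by norm_num) (by norm_num) hlow hcomp
  have hρ : (9603/1000 - 2 * (l : ℝ)) / ((h : ℝ) - l) ≤ pairGate (99/125) (9603/1000) l h := le_max_left _ _
  simp only [usage, gateOf, if_neg hh]
  refine hρ.trans ?_
  rw [le_div_iff₀ (by linarith)]
  nlinarith

/-- the rate of a compatible pair is nonnegative (frame, layer `11`). [this work] -/
theorem usage_nonneg_11 (l h : ℕ) (hlow : 2 * (l : ℝ) < 9603/1000) (hcomp : 11 + 1 ≤ h ∨ (9603/1000 : ℝ) < (l : ℝ) + h) :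
    0 ≤ usage (99/125) (9603/1000) 11 l h := by
  by_cases hg : 11 + 1 ≤ h
  · rw [usage_giant_eq _ _ _ _ _ hg]; norm_num
  · rcases hcomp with hc | hc
    · exact absurd hc hg
    · have hlt : l < h := by
        by_contra hcon
        push Not at hcon
        have : (h : ℝ) ≤ l := by exact_mod_cast hcon
        linarith
      have hG0 := pairGate_pos (99/125) (9603/1000) l h hlow hlt
      have hG1 := pairGate_lt_one (99/125) (9603/1000) l h (by norm_num) (by norm_num) hlow hc
      simp only [usage, gateOf, if_neg hg]
      exact div_nonneg hG0.le (by linarith)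

/-- a compatible mid of the frame at layer `11` has rate `≥ 1/100`. [this work] -/
theorem usage_ge_hundredth (l h : ℕ) (hlow : 2 * (l : ℝ) < 9603/1000) (hhM : h ≤ 12) (hcomp : (9603/1000 : ℝ) < (l : ℝ) + h)
    (hh : ¬ 11 + 1 ≤ h) : (1/100 : ℝ) ≤ usage (99/125) (9603/1000) 11 l h := by
  have hρ := usage_ge_rho l h hlow hcomp hh
  have hh11 : (h : ℝ) ≤ 11 := by exact_mod_cast (show h ≤ 11 by omega)
  have hhl : (l : ℝ) < h := by
    have : l < h := by
      by_contra hcon; push Not at hcon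
      have : (h : ℝ) ≤ l := by exact_mod_cast hcon
      linarith
    exact_mod_cast this
  have hl4 : (l : ℝ) ≤ 4 := by
    have : l ≤ 4 := by
      by_contra hcon; push Not at hcon
      have : (5 : ℝ) ≤ (l : ℝ) := by exact_mod_cast hcon
      linarith
    exact_mod_cast this
  have hρ' : (1/100 : ℝ) ≤ (9603/1000 - 2 * (l : ℝ)) / ((h : ℝ) - l) := by
    rw [le_div_iff₀ (by linarith)]; linarith
  exact hρ'.trans hρ

/-! ### P1 — layer 11, the giant `12` alone -/

/-- **price system P1** (`α ≡ 1`, `β₁₂ = 26/99`, `β = 100` on the mids) is feasible. [this work] -/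
theorem prices_P1 : ∀ (l h : ℕ), l ≤ 11 → 2 * (l : ℝ) < 9603/1000 → h ≤ 12 → (11 + 1 ≤ h ∨ (9603/1000 : ℝ) < (l : ℝ) + h) →
    (fun _ : ℕ => (1 : ℝ)) l ≤ usage (99/125) (9603/1000) 11 l h * (fun h : ℕ => if h = 12 then (26/99 : ℝ) else 100) h := by
  intro l h _ hlow hhM hc
  by_cases hg : 11 + 1 ≤ h
  · have h12 : h = 12 := by omega
    subst h12
    rw [usage_giant_eq _ _ _ _ _ hg]; norm_num
  · rcases hc with hc | hc
    · exact absurd hc hg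
    · have hne : h ≠ 12 := by omega
      simp only [if_neg hne]
      have hu := usage_ge_hundredth l h hlow hhM hc hg
      linarith

/-- **a pair `{k, 12}` (`k ∈ {1,2,4}`) of mean `97/10` — necessarily light, `γ ≤ 87/110 < 4/5` — is NOT admissible at `M = 12`**: at layer `11`
only the giant `12` absorbs, at gate `≥ y`, which needs `qγ ≥ y`. [this work] -/
theorem lightTop_absurd (lo : ℕ) (hlo : lo = 1 ∨ lo = 2 ∨ lo = 4) (γ : ℝ)
    (hmean : (lo : ℝ) + (((12 : ℕ) : ℝ) - lo) * γ = 97/10)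
    (hdec : DECAt (99/125) 11 12 (gate (fun h => TP[lo, 12, γ, h]) (99/100))) : False := by
  have hmeanN : ∑ h ∈ Finset.range (12 + 1), (h : ℝ) * gate (fun h => TP[lo, 12, γ, h]) (99/100) h = 9603/1000 := by
    rcases hlo with rfl | rfl | rfl <;>
      · simp only [Finset.sum_range_succ, Finset.sum_range_zero, gate]
        norm_num at hmean ⊢; linarith
  rw [decAt_iff_decAtT, hmeanN] at hdec
  have key := dual_le_of_decAtT (99/125) (9603/1000) 11 12 _ (by norm_num) (by norm_num) hdec (fun _ : ℕ => (1 : ℝ))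
    (fun h : ℕ => if h = 12 then (26/99 : ℝ) else 100) (fun h => by split_ifs <;> norm_num) prices_P1
  rcases hlo with rfl | rfl | rfl <;>
    · norm_num [Finset.sum_range_succ, gate] at key
      linarith

/-- **a triple `{a, b, 12}` with `a < b ≤ 4` of mean `97/10` is NOT admissible at `M = 12`**: at layer `11` all of `0, a, b` are lows and only
the giant `12` absorbs (P1), forcing `q·p₁₂ ≥ y`, while the mean forces `p₁₂ ≤ 87/110`. [this work] -/
theorem triple_lowTop_absurd (a b : ℕ) (hab : (a = 1 ∧ b = 2) ∨ (a = 1 ∧ b = 4) ∨ (a = 2 ∧ b = 4)) (p₁ p₂ p₃ : ℝ)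
    (hp₂ : 0 ≤ p₂) (hsum : p₁ + p₂ + p₃ = 1)
    (hmean : p₁ * (a : ℝ) + p₂ * (b : ℝ) + p₃ * ((12 : ℕ) : ℝ) = 97/10)
    (hdec : DECAt (99/125) 11 12 (gate (fun h => TR[a, b, 12, p₁, p₂, p₃, h]) (99/100))) : False := by
  have hmeanN : ∑ h ∈ Finset.range (12 + 1), (h : ℝ) * gate (fun h => TR[a, b, 12, p₁, p₂, p₃, h]) (99/100) h = 9603/1000 := by
    rcases hab with ⟨rfl, rfl⟩ | ⟨rfl, rfl⟩ | ⟨rfl, rfl⟩ <;>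
      · simp only [Finset.sum_range_succ, Finset.sum_range_zero, gate]
        norm_num at hmean ⊢; linarith
  rw [decAt_iff_decAtT, hmeanN] at hdec
  have key := dual_le_of_decAtT (99/125) (9603/1000) 11 12 _ (by norm_num) (by norm_num) hdec (fun _ : ℕ => (1 : ℝ))
    (fun h : ℕ => if h = 12 then (26/99 : ℝ) else 100) (fun h => by split_ifs <;> norm_num) prices_P1
  rcases hab with ⟨rfl, rfl⟩ | ⟨rfl, rfl⟩ | ⟨rfl, rfl⟩ <;>
    · norm_num [Finset.sum_range_succ, gate] at key
      push_cast at hmean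
      linarith

/-! ### P2 — layer 5, the giants `6, …, 12` -/

/-- **price system P2** (`α ≡ 1`, `β ≡ 26/99`) is feasible at layer `5` (no mid is compatible with a low). [this work] -/
theorem prices_P2 : ∀ (l h : ℕ), l ≤ 5 → 2 * (l : ℝ) < 9603/1000 → h ≤ 12 → (5 + 1 ≤ h ∨ (9603/1000 : ℝ) < (l : ℝ) + h) →
    (fun _ : ℕ => (1 : ℝ)) l ≤ usage (99/125) (9603/1000) 5 l h * (fun _ : ℕ => (26/99 : ℝ)) h := by
  intro l h _ hlow _ hc
  have hl4 : l ≤ 4 := by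
    by_contra hcon
    push Not at hcon
    have : (5 : ℝ) ≤ (l : ℝ) := by exact_mod_cast hcon
    linarith
  by_cases hg : 5 + 1 ≤ h
  · rw [usage_giant_eq _ _ _ _ _ hg]; norm_num
  · exfalso
    rcases hc with hc | hc
    · exact hg hc
    · have h9 : (l : ℝ) + h ≤ 9 := by
        have : l + h ≤ 9 := by omega
        exact_mod_cast this
      linarith

/-- **P2 cut**: an admissible triple `{a, b, 12}` with `a ≤ 4 < 9 ≤ b ≤ 10` has low mass `1/100 + (99/100)·p₁ ≤ (26/99)·(99/100)·(p₂ + p₃)`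
(i.e. `p₁ ≤ 1/5`). [this work] -/
theorem triple_P2_cut (a b : ℕ) (hab : (a = 2 ∧ b = 9) ∨ (a = 2 ∧ b = 10) ∨ (a = 4 ∧ b = 9) ∨ (a = 4 ∧ b = 10)) (p₁ p₂ p₃ : ℝ)
    (hmean : p₁ * (a : ℝ) + p₂ * (b : ℝ) + p₃ * ((12 : ℕ) : ℝ) = 97/10)
    (hdec : DECAt (99/125) 5 12 (gate (fun h => TR[a, b, 12, p₁, p₂, p₃, h]) (99/100))) :
    1/100 + 99/100 * p₁ ≤ 26/99 * (99/100 * p₂) + 26/99 * (99/100 * p₃) := by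
  have hmeanN : ∑ h ∈ Finset.range (12 + 1), (h : ℝ) * gate (fun h => TR[a, b, 12, p₁, p₂, p₃, h]) (99/100) h = 9603/1000 := by
    rcases hab with ⟨rfl, rfl⟩ | ⟨rfl, rfl⟩ | ⟨rfl, rfl⟩ | ⟨rfl, rfl⟩ <;>
      · simp only [Finset.sum_range_succ, Finset.sum_range_zero, gate]
        norm_num at hmean ⊢; linarith
  rw [decAt_iff_decAtT, hmeanN] at hdec
  have key := dual_le_of_decAtT (99/125) (9603/1000) 5 12 _ (by norm_num) (by norm_num) hdec (fun _ : ℕ => (1 : ℝ))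
    (fun _ : ℕ => (26/99 : ℝ)) (fun _ => by norm_num) prices_P2
  rcases hab with ⟨rfl, rfl⟩ | ⟨rfl, rfl⟩ | ⟨rfl, rfl⟩ | ⟨rfl, rfl⟩ <;>
    · norm_num [Finset.sum_range_succ, gate] at key
      linarith

/-! ### P3 — layer 11 with a priced mid -/

/-- exact rate `usage(1, 9) = 7603/397` at layer `11`. [this work] -/
theorem usage_1_9 : usage (99/125) (9603/1000) 11 1 9 = 7603/397 := by
  norm_num [usage, gateOf, pairGate, max_def]

/-- exact rate `usage(1, 10) = 7603/1397` at layer `11`. [this work] -/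
theorem usage_1_10 : usage (99/125) (9603/1000) 11 1 10 = 7603/1397 := by
  norm_num [usage, gateOf, pairGate, max_def]

/-- exact rate `usage(0, 10) = 9603/397` at layer `11`. [this work] -/
theorem usage_0_10 : usage (99/125) (9603/1000) 11 0 10 = 9603/397 := by
  norm_num [usage, gateOf, pairGate, max_def]

/-- **price system P3(1,9)** (`α = 1` on `{0,1}`, `β₁₂ = 26/99`, `β₉ = 397/7603`, `β = 100` elsewhere) is feasible. [this work] -/
theorem prices_P3_9 : ∀ (l h : ℕ), l ≤ 11 → 2 * (l : ℝ) < 9603/1000 → h ≤ 12 → (11 + 1 ≤ h ∨ (9603/1000 : ℝ) < (l : ℝ) + h) →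
    (fun l : ℕ => if l ≤ 1 then (1 : ℝ) else 0) l
      ≤ usage (99/125) (9603/1000) 11 l h * (fun h : ℕ => if h = 12 then (26/99 : ℝ) else if h = 9 then 397/7603 else 100) h := by
  intro l h _ hlow hhM hc
  dsimp only
  have hu0 := usage_nonneg_11 l h hlow hc
  have hβ0 : 0 ≤ (if h = 12 then (26/99 : ℝ) else if h = 9 then 397/7603 else 100) := by
    split_ifs <;> norm_num
  by_cases hl1 : l ≤ 1
  · rw [if_pos hl1]
    by_cases hg : 11 + 1 ≤ h
    · have h12 : h = 12 := by omega
      subst h12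
      rw [usage_giant_eq _ _ _ _ _ hg]; norm_num
    · rcases hc with hc | hc
      · exact absurd hc hg
      · have hne : h ≠ 12 := by omega
        by_cases h9 : h = 9
        · subst h9
          have hl : l = 1 := by
            rcases Nat.le_one_iff_eq_zero_or_eq_one.1 hl1 with rfl | rfl
            · norm_num at hc
            · rfl
          subst hl
          rw [if_neg hne, if_pos rfl, usage_1_9]; norm_num
        · rw [if_neg hne, if_neg h9]
          have hu := usage_ge_hundredth l h hlow hhM hc hg
          linarith
  · rw [if_neg hl1]
    exact mul_nonneg hu0 hβ0

/-- **price system P3(1,10)** (`α = 1` on `{0,1}`, `β₁₂ = 26/99`, `β₁₀ = 1397/7603`, `β = 100` elsewhere) is feasible. [this work] -/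
theorem prices_P3_10 : ∀ (l h : ℕ), l ≤ 11 → 2 * (l : ℝ) < 9603/1000 → h ≤ 12 → (11 + 1 ≤ h ∨ (9603/1000 : ℝ) < (l : ℝ) + h) →
    (fun l : ℕ => if l ≤ 1 then (1 : ℝ) else 0) l
      ≤ usage (99/125) (9603/1000) 11 l h * (fun h : ℕ => if h = 12 then (26/99 : ℝ) else if h = 10 then 1397/7603 else 100) h := by
  intro l h _ hlow hhM hc
  dsimp only
  have hu0 := usage_nonneg_11 l h hlow hc
  have hβ0 : 0 ≤ (if h = 12 then (26/99 : ℝ) else if h = 10 then 1397/7603 else 100) := by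
    split_ifs <;> norm_num
  by_cases hl1 : l ≤ 1
  · rw [if_pos hl1]
    by_cases hg : 11 + 1 ≤ h
    · have h12 : h = 12 := by omega
      subst h12
      rw [usage_giant_eq _ _ _ _ _ hg]; norm_num
    · rcases hc with hc | hc
      · exact absurd hc hg
      · have hne : h ≠ 12 := by omega
        by_cases h10 : h = 10
        · subst h10
          rw [if_neg hne, if_pos rfl]
          rcases Nat.le_one_iff_eq_zero_or_eq_one.1 hl1 with rfl | rfl
          · rw [usage_0_10]; norm_num
          · rw [usage_1_10]; norm_num
        · rw [if_neg hne, if_neg h10]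
          have hu := usage_ge_hundredth l h hlow hhM hc hg
          linarith
  · rw [if_neg hl1]
    exact mul_nonneg hu0 hβ0

/-- **P3 cut for `{1, 9, 12}`**: `1/100 + (99/100)p₁ ≤ (397/7603)(99/100)p₂ + (26/99)(99/100)p₃`. [this work] -/
theorem triple_P3_cut_1_9 (p₁ p₂ p₃ : ℝ)
    (hmean : p₁ * ((1 : ℕ) : ℝ) + p₂ * ((9 : ℕ) : ℝ) + p₃ * ((12 : ℕ) : ℝ) = 97/10)
    (hdec : DECAt (99/125) 11 12 (gate (fun h => TR[1, 9, 12, p₁, p₂, p₃, h]) (99/100))) :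
    1/100 + 99/100 * p₁ ≤ 397/7603 * (99/100 * p₂) + 26/99 * (99/100 * p₃) := by
  have hmeanN : ∑ h ∈ Finset.range (12 + 1), (h : ℝ) * gate (fun h => TR[1, 9, 12, p₁, p₂, p₃, h]) (99/100) h = 9603/1000 := by
    simp only [Finset.sum_range_succ, Finset.sum_range_zero, gate]
    norm_num at hmean ⊢; linarith
  rw [decAt_iff_decAtT, hmeanN] at hdec
  have key := dual_le_of_decAtT (99/125) (9603/1000) 11 12 _ (by norm_num) (by norm_num) hdec
    (fun l : ℕ => if l ≤ 1 then (1 : ℝ) else 0)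
    (fun h : ℕ => if h = 12 then (26/99 : ℝ) else if h = 9 then 397/7603 else 100)
    (fun h => by split_ifs <;> norm_num) prices_P3_9
  norm_num [Finset.sum_range_succ, gate] at key
  linarith

/-- **P3 cut for `{1, 10, 12}`**: `1/100 + (99/100)p₁ ≤ (1397/7603)(99/100)p₂ + (26/99)(99/100)p₃` (tight at the Farkas vertex). [this work] -/
theorem triple_P3_cut_1_10 (p₁ p₂ p₃ : ℝ)
    (hmean : p₁ * ((1 : ℕ) : ℝ) + p₂ * ((10 : ℕ) : ℝ) + p₃ * ((12 : ℕ) : ℝ) = 97/10)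
    (hdec : DECAt (99/125) 11 12 (gate (fun h => TR[1, 10, 12, p₁, p₂, p₃, h]) (99/100))) :
    1/100 + 99/100 * p₁ ≤ 1397/7603 * (99/100 * p₂) + 26/99 * (99/100 * p₃) := by
  have hmeanN : ∑ h ∈ Finset.range (12 + 1), (h : ℝ) * gate (fun h => TR[1, 10, 12, p₁, p₂, p₃, h]) (99/100) h = 9603/1000 := by
    simp only [Finset.sum_range_succ, Finset.sum_range_zero, gate]
    norm_num at hmean ⊢; linarith
  rw [decAt_iff_decAtT, hmeanN] at hdec
  have key := dual_le_of_decAtT (99/125) (9603/1000) 11 12 _ (by norm_num) (by norm_num) hdec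
    (fun l : ℕ => if l ≤ 1 then (1 : ℝ) else 0)
    (fun h : ℕ => if h = 12 then (26/99 : ℝ) else if h = 10 then 1397/7603 else 100)
    (fun h => by split_ifs <;> norm_num) prices_P3_10
  norm_num [Finset.sum_range_succ, gate] at key
  linarith

/-! ### The witness triple is admissible -/

/-- **`gate_q ω₁ = {0: 1/100, 1: 99/1000, 2: 99/500, 4: 693/1000}` is DEC at every layer `j′ < 4`**: the top atom `4` is a giant at every
layer and absorbs the lows `0, 1` at gate `y` (`(99/26)·0.109 ≤ 0.693`). [this work] -/
theorem omega1_dec : ∀ j', j' < 4 →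
    DECAt (99/125) j' 4 (gate (fun h => TR[1, 2, 4, (1/10 : ℝ), (1/5 : ℝ), (7/10 : ℝ), h]) (99/100)) := by
  intro j' hj
  have hμM : ∀ h, 4 < h → gate (fun h => TR[1, 2, 4, (1/10 : ℝ), (1/5 : ℝ), (7/10 : ℝ), h]) (99/100) h = 0 := by
    intro h hh
    simp only [gate]
    rw [if_neg (by omega), if_neg (by omega), if_neg (by omega), if_neg (by omega)]
    ring
  have hμ0 : ∀ h, 0 ≤ gate (fun h => TR[1, 2, 4, (1/10 : ℝ), (1/5 : ℝ), (7/10 : ℝ), h]) (99/100) h := by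
    intro h
    simp only [gate]
    split_ifs <;> norm_num
  have hμ1 : ∑ h ∈ Finset.range (4 + 1), gate (fun h => TR[1, 2, 4, (1/10 : ℝ), (1/5 : ℝ), (7/10 : ℝ), h]) (99/100) h = 1 := by
    simp only [Finset.sum_range_succ, Finset.sum_range_zero, gate]; norm_num
  have hmeanN : ∑ h ∈ Finset.range (4 + 1), (h : ℝ) * gate (fun h => TR[1, 2, 4, (1/10 : ℝ), (1/5 : ℝ), (7/10 : ℝ), h]) (99/100) h
      = 3267/1000 := by
    simp only [Finset.sum_range_succ, Finset.sum_range_zero, gate]; norm_num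
  rw [decAt_iff_decAtT, hmeanN]
  refine decAtT_of_flowAtT _ _ j' 4 _ (by norm_num) (by norm_num) hμM hμ1
    (flowAtT_of_giants _ _ j' 4 _ (by norm_num) (by norm_num) hμ0 ?_)
  interval_cases j' <;>
    · rw [Finset.sum_Ico_eq_sum_range]
      norm_num [Finset.sum_range_succ, Finset.sum_range_zero, gate]

end AD3ProdCellCex

end LawDec

end Quant

end Summit.CriticalPhenomena.PercolationContinuityZ3.Theorems
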